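import Literature.MathematicalPhysics.QuantumFieldTheory.Balaban1983to89.B6SectAOperatorsV1
import Literature.MathematicalPhysics.QuantumFieldTheory.Balaban1983to89.B6Eq211

/-!
# `Balaban1983to89.B6SectAPoincare211V1` — T. Bałaban, *Propagators and renormalization transformations for lattice gauge theories. II*,
# Commun. Math. Phys. **96** (1984) 223–250 [Balaban1984PropagatorsII], **(2.11) p. 225 ON THE V1 MULTI-LEVEL TORUS CALCULUS**: r03∕p21's nested
# families `D : Domains P` READ AS A BLOCK SYSTEM of p03's `B6Eq211` (whose (2.11) `ineq211_eight` holds on every block system), hence the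
# Poincaré letter `(8c²∕L^{2k})·‖λ‖² ≤ ‖∂λ‖²` for every `λ ∈ N(Q′) = ker Q′` of the V1 model

statement-level skeleton of published theorems with citation tags; proofs where landed; nothing here is a claim about the Yang–Mills mass gap

PDF held: `paper:balaban1984-cmp96-propagators-rt-ii` (journal page = PDF page + 222), p. 225 (through the verbatim quotation in `B6Eq211`).

CITATION HEADER (lean-in-tree rule).  Cell `pub-ymgap` (Track A, HUMAN RULING D-0062), node N10 [B13] lane owner `pub-ymgap-dag-n10-c` (g17), ROAD «C» station C3
(bus INBOX 2026-08-28T15:23Z; C1 = `B6SectADeltaACoerciveReductionV1`, C2 = `B6SectATreeGaugeDecompositionV1`), filed `--supports stmt-QuantumFields-27364`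
(count-neutral helper).  WHY: C1 reduces the volume-uniform coercivity of `Δ_a` (2.19) in the V1 model to three letters; THIS FILE supplies the (2.11)-shaped letter
`π‖λ‖² ≤ ‖∂λ‖²` on `N(Q′)` with `π = 8c²∕L^{2k}` EXPLICIT, by INSTANTIATING p03's abstract carrier `B6Eq211.BlockSystem` («the blocks are abstract charts … the tori
`T^{(j)}` of `Setup` are one admissible instance», its docstring) at the V1 geometry: sites `Site P 0`, bonds `PBond P 0`, `Λ₀` = the level-0 sites of `D`, blocks =
the `Λ_j`-blocks `B^j(y)`, `j ≥ 1`, charted by their integer labels.  IMPORTS `B6SectAOperatorsV1` (V1 model) + `B6Eq211` (p03; `ineq211_eight` =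
[Balaban1983RegularityDecay] (2.27)'s mean-zero block Poincaré with its lattice constant 8); nothing restated.

THE PRINT (verbatim, p. 225): *«the Laplace operator Δ is positive on the subspace N(Q′), hence it is invertible on this subspace. More exactly we have the inequality
⟨λ, Δλ⟩ ≥ π² Σ_{j=1}^k (L^jη)^{−2} Σ_{x∈B^j(Λ_j)} η^d|λ(x)|², λ ∈ N(Q′), (2.11) as it follows from [3, 2.26, and 2.27].»*  (The valid universal constant is `8`,
not `π²`: `B6Eq211PiSqRefuted`; harmless, cited.)

WHAT IS DEFINED (bodies displayed; definition lane) AND PROVED (sorry-free; standard axioms).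
* `LevelBlock D` — the index of the blocks of `𝔅` above level 0: pairs `(j, y)` with `1 ≤ j ≤ k`, `y ∈ Λ_j`; `chartV1 D b t` — the site of `B^j(y)` with labels
  `y_μ·L^j + t_μ`, `t ∈ {0,…,L^j − 1}^d`; ★ `blockSystemV1 D : BlockSystem (Site P 0) (PBond P 0) (LevelBlock D)` (`η = 1`, `d = P.d`, `Λ₀ = {x | x ∈ Λ_0}`).
* chart facts: `val_chartV1`, `chartV1_mem_iterBlock`, `chartV1_injective`, `chartV1_disjoint`, `shift_chartV1` (internal steps), `image_chartV1` (the chart is ONTO `B^j(y)`),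
  `sum_chartV1` (`Σ_t f(chart t) = Σ_{x∈B^j(y)} f x`).
* readings: `form_blockSystemV1` (`c²·form λ = ‖∂λ‖²`), `inGaugeSpace_of_mem_ker` (`λ ∈ ker Q′ ⇒ λ ∈ N(Q′)` of the block system), `normSq_eq_sum_blocks_of_mem_ker`
  (`‖λ‖² = Σ_b Σ_{x∈b} λ(x)²` for `λ ∈ ker Q′`: `λ = 0` on `Λ₀`, the blocks partition the rest — (2.4)).
* ★★★ `poincare211_levels_V1`: `8·c²·Σ_b (Σ_{x∈b} λ(x)²)∕(L^{j_b})² ≤ ‖∂λ‖²` for `λ ∈ ker (QpE D)` (the blockwise∕levelwise form of (2.11));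
  ★★★ `poincare211_V1`: **`(8·c²∕(L^k)²)·‖λ‖² ≤ ‖∂λ‖²` for every `λ ∈ ker (QpE D)`** — the `hP` letter of C1's `deltaAE_coercive_of_treeGauge_letters` with `π = 8c²∕L^{2k}`.
HONEST SCOPE.  A carrier instantiation + bookkeeping; the one estimate is p03's kernel theorem `ineq211_eight` ([3] (2.27) with constant 8); NOT a node discharge;
count-neutral; nothing continuum ∕ OS ∕ mass gap ∕ Clay.
-/

open scoped InnerProductSpace

namespace Literature.MathematicalPhysics.QuantumFieldTheory.Balaban1983to89.B6SectAPoincare211V1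

open LatticeFieldCalculus B5Eq118OneStroke B6SectADomainsV1 B6SectAOperatorsV1
open Beta.CoordCubePoincare (stepUp)
open B6Eq211 (BlockSystem)

noncomputable section

open Classical in
/-- the blocks of `𝔅 = ⋃_j Λ_j` above level `0`: pairs `(j, y)`, `1 ≤ j ≤ k`, `y ∈ Λ_j` (the `j`-blocks `B^j(y)` on which (2.7) imposes `Q′_jλ = 0`).
[cite: Balaban1984PropagatorsII, (2.3)–(2.4) p.224, (2.7) p.224] -/
abbrev LevelBlock {P : Params} (D : Domains P) : Type :=
  (j : Fin (D.k + 1)) × {y : Site P (j : ℕ) // D.LamSite (j : ℕ) y ∧ 1 ≤ (j : ℕ)}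

variable {P : Params} {D : Domains P}

/-- the level of a block. [cite: Balaban1984PropagatorsII, (2.3) p.224] -/
abbrev LevelBlock.lvl (b : LevelBlock D) : ℕ := (b.1 : ℕ)

/-- the coarse site of a block. [cite: Balaban1984PropagatorsII, (2.3) p.224] -/
abbrev LevelBlock.site (b : LevelBlock D) : Site P b.lvl := b.2.1

/-- the level of a block is in the standing range `j ≤ m + K`. [cite: Balaban1984PropagatorsII, (2.1) p.224] -/
theorem LevelBlock.lvl_le (b : LevelBlock D) : b.lvl ≤ P.m + P.K := (D.le_of_lamSite b.2.2.1).trans D.hk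

/-- the block's coarse site lies in `Λ_j`. [cite: Balaban1984PropagatorsII, (2.3) p.224] -/
theorem LevelBlock.lamSite (b : LevelBlock D) : D.LamSite b.lvl b.site := b.2.2.1

/-- `1 ≤ j` for the blocks above level 0. [cite: Balaban1984PropagatorsII, (2.3) p.224] -/
theorem LevelBlock.one_le_lvl (b : LevelBlock D) : 1 ≤ b.lvl := b.2.2.2

variable (D)

/-- `side + 1 = L^j`: the number of sites per direction of a `j`-block minus one. [cite: Balaban1984PropagatorsI, (1.6) p.18] -/
def sideV1 (b : LevelBlock D) : ℕ := P.L ^ b.lvl - 1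

/-- `sideV1 b + 1 = L^j`. [cite: Balaban1984PropagatorsI, (1.6) p.18] -/
theorem sideV1_succ (b : LevelBlock D) : sideV1 D b + 1 = P.L ^ b.lvl :=
  Nat.sub_add_cancel (Nat.one_le_pow _ _ P.L_pos)

/-- **the chart of the block `B^j(y)`**: `t ↦` the fine site with labels `y_μ·L^j + t_μ` (B5 (1.6): `B(y)` = the sites with `y_μ ≤ L⁻ʲx_μ < y_μ + 1`, centred-label reading
of `Setup`). [cite: Balaban1984PropagatorsI, (1.6) p.18] -/
def chartV1 (b : LevelBlock D) (t : Fin P.d → Fin (sideV1 D b + 1)) : Site P 0 :=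
  fun μ => (((b.site μ).val * P.L ^ b.lvl + (t μ).val : ℕ) : ZMod (P.sitesPerDir 0))

/-- the labels of the chart do not wrap around the torus. [cite: Balaban1984PropagatorsI, (1.6) p.18] -/
theorem chartV1_lt (b : LevelBlock D) (t : Fin P.d → Fin (sideV1 D b + 1)) (μ : Fin P.d) :
    (b.site μ).val * P.L ^ b.lvl + (t μ).val < P.sitesPerDir 0 := by
  have ht : (t μ).val < P.L ^ b.lvl := lt_of_lt_of_eq (t μ).isLt (sideV1_succ D b)
  have hy : (b.site μ).val + 1 ≤ P.sitesPerDir b.lvl := ZMod.val_lt _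
  -- `sitesPerDir 0 = sitesPerDir j · L^j` in the standing range (`BIJ85Ineq722Torus.sitesPerDir_zero_eq`, not imported for one line)
  have hsp : P.sitesPerDir 0 = P.sitesPerDir b.lvl * P.L ^ b.lvl := by
    unfold Params.sitesPerDir
    rw [Nat.sub_zero, mul_assoc, ← pow_add, Nat.sub_add_cancel b.lvl_le]
  rw [hsp]
  calc (b.site μ).val * P.L ^ b.lvl + (t μ).val < (b.site μ).val * P.L ^ b.lvl + P.L ^ b.lvl := by omega
    _ = ((b.site μ).val + 1) * P.L ^ b.lvl := by ring
    _ ≤ P.sitesPerDir b.lvl * P.L ^ b.lvl := Nat.mul_le_mul_right _ hy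

/-- the label of a charted site. [cite: Balaban1984PropagatorsI, (1.6) p.18] -/
theorem val_chartV1 (b : LevelBlock D) (t : Fin P.d → Fin (sideV1 D b + 1)) (μ : Fin P.d) :
    (chartV1 D b t μ).val = (b.site μ).val * P.L ^ b.lvl + (t μ).val := by
  rw [chartV1, ZMod.val_natCast, Nat.mod_eq_of_lt (chartV1_lt D b t μ)]

/-- charted sites lie in the block: `chart_b(t) ∈ B^j(y)`. [cite: Balaban1984PropagatorsI, (1.6) p.18] -/
theorem chartV1_mem_iterBlock (b : LevelBlock D) (t : Fin P.d → Fin (sideV1 D b + 1)) : chartV1 D b t ∈ iterBlock b.lvl b.site := by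
  rw [mem_iterBlock_iff b.lvl_le]
  intro μ
  have ht : (t μ).val < P.L ^ b.lvl := lt_of_lt_of_eq (t μ).isLt (sideV1_succ D b)
  rw [val_chartV1, mul_comm, Nat.mul_add_div (pow_pos P.L_pos _), Nat.div_eq_of_lt ht, add_zero]

/-- the chart is injective. [cite: Balaban1984PropagatorsI, (1.6) p.18] -/
theorem chartV1_injective (b : LevelBlock D) : Function.Injective (chartV1 D b) := by
  intro t t' h
  funext μ
  have hμ := congrArg (fun x : Site P 0 => (x μ).val) h
  simp only [val_chartV1] at hμ
  exact Fin.ext (by omega)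

/-- distinct blocks of `𝔅` are disjoint (the blocks `B^j(Λ_j)`, `j = 0, …, k`, partition `T` — (2.4); `Domains.lamSite_iterBlockOf_unique`).
[cite: Balaban1984PropagatorsII, (2.4) p.224] -/
theorem chartV1_disjoint (b b' : LevelBlock D) (hbb : b ≠ b') (t : Fin P.d → Fin (sideV1 D b + 1)) (t' : Fin P.d → Fin (sideV1 D b' + 1)) :
    chartV1 D b t ≠ chartV1 D b' t' := by
  intro h
  have hx := chartV1_mem_iterBlock D b t
  have hx' := chartV1_mem_iterBlock D b' t'
  rw [h] at hx
  rw [mem_iterBlock] at hx hx'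
  -- same level
  have hj : b.lvl = b'.lvl := D.lamSite_iterBlockOf_unique (x := chartV1 D b' t') (by rw [hx]; exact b.lamSite) (by rw [hx']; exact b'.lamSite)
  apply hbb
  obtain ⟨j, y, hy⟩ := b
  obtain ⟨j', y', hy'⟩ := b'
  have hjj : j = j' := Fin.ext hj
  subst hjj
  have hyy : y = y' := hx.symm.trans hx'
  subst hyy
  rfl

/-- an internal step of the chart is a lattice step: `chart(t + e_μ) = chart(t) + e_μ` for `t_μ < side`. [cite: Balaban1984PropagatorsI, (1.6) p.18] -/
theorem shift_chartV1 (b : LevelBlock D) (μ : Fin P.d) (t : Fin P.d → Fin (sideV1 D b + 1)) (ht : t μ ≠ Fin.last (sideV1 D b)) :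
    (chartV1 D b t).shift μ = chartV1 D b (stepUp t μ) := by
  funext ν
  by_cases hν : ν = μ
  · subst hν
    simp only [Site.shift, Function.update_self, chartV1, stepUp]
    have hval : ((t ν + 1 : Fin (sideV1 D b + 1)) : ℕ) = (t ν : ℕ) + 1 := Fin.val_add_one_of_lt (Fin.lt_last_iff_ne_last.mpr ht)
    rw [hval]; push_cast; ring
  · simp only [Site.shift, Function.update_of_ne hν, chartV1, stepUp]

/-- **the V1 geometry as a block system of `B6Eq211`** (`η = 1`; `Λ₀` = the level-0 sites of `D`; blocks = `B^j(y)`, `y ∈ Λ_j`, `j ≥ 1`, charted by labels).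
[cite: Balaban1984PropagatorsII, (2.1)–(2.4) p.224, (2.7) p.224, (2.11) p.225] -/
def blockSystemV1 : BlockSystem (Site P 0) (PBond P 0) (LevelBlock D) where
  d := P.d
  η := 1
  src := PBond.src
  tgt := PBond.tgt
  zeroSet := {x | D.LamSite 0 x}
  side := sideV1 D
  chart := chartV1 D
  bond := fun b μ t => ⟨chartV1 D b t, μ⟩
  η_pos := one_pos
  chart_injective := chartV1_injective D
  chart_disjoint := chartV1_disjoint D
  src_bond := fun _ _ _ _ => rfl
  tgt_bond := fun b μ t ht => shift_chartV1 D b μ t ht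

/-- the chart is onto its block: `chart_b({0,…,L^j−1}^d) = B^j(y)`. [cite: Balaban1984PropagatorsI, (1.6) p.18, (1.18) p.20] -/
theorem image_chartV1 (b : LevelBlock D) : Finset.univ.image (chartV1 D b) = iterBlock b.lvl b.site := by
  apply Finset.eq_of_subset_of_card_le
  · intro x hx
    obtain ⟨t, _, rfl⟩ := Finset.mem_image.mp hx
    exact chartV1_mem_iterBlock D b t
  · rw [Finset.card_image_of_injective _ (chartV1_injective D b), Finset.card_univ, card_iterBlock _ b.lvl_le,
      Fintype.card_pi, Finset.prod_const, Finset.card_univ, Fintype.card_fin, Fintype.card_fin, sideV1_succ, ← pow_mul, ← pow_mul, mul_comm]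

/-- a sum over the chart is the sum over the block. [cite: Balaban1984PropagatorsI, (1.18) p.20] -/
theorem sum_chartV1 (b : LevelBlock D) (f : Site P 0 → ℝ) : ∑ t, f (chartV1 D b t) = ∑ x ∈ iterBlock b.lvl b.site, f x := by
  rw [← image_chartV1, Finset.sum_image fun t _ t' _ h => chartV1_injective D b h]

/-- the form of the block system is `‖∂λ‖²∕c²`: `c²·Σ_bonds (λ(b₊) − λ(b₋))² = ‖∂λ‖²`. [cite: Balaban1984PropagatorsII, (2.8) p.224, (2.11) p.225] -/
theorem form_blockSystemV1 (c : ℝ) (n : ScalarSpace P) :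
    c ^ 2 * (blockSystemV1 D).form (WithLp.ofLp n) = ‖dE c n‖ ^ 2 := by
  rw [BlockSystem.form, ← real_inner_self_eq_norm_sq, inner_eq_sum, Finset.mul_sum]
  refine Finset.sum_congr rfl fun b _ => ?_
  simp only [blockSystemV1, one_pow, div_one, one_mul, dE_apply, grad, smul_eq_mul]
  ring

/-- `λ ∈ ker Q′` is a gauge function of the block system: `λ = 0` on `Λ₀` and every block sum of `λ` vanishes ((2.7); `Q′_j` = block mean, (1.20)).
[cite: Balaban1984PropagatorsII, (2.7) p.224, (2.10) p.225; Balaban1984PropagatorsI, (1.20) p.20] -/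
theorem inGaugeSpace_of_mem_ker {n : ScalarSpace P} (hn : n ∈ LinearMap.ker (QpE D)) : (blockSystemV1 D).InGaugeSpace (WithLp.ofLp n) := by
  have hg := (mem_ker_QpE_iff D n).mp hn
  refine ⟨fun x hx => ?_, fun b => ?_⟩
  · have h0 := hg 0 x hx
    simpa [siteAvgIter] using h0
  · have hb := hg b.lvl b.site b.2.2.1
    rw [siteAvgIter_eq_blockSum _ b.lvl_le, smul_eq_mul, mul_eq_zero] at hb
    rcases hb with hb | hb
    · exact absurd hb (inv_ne_zero (pow_ne_zero _ (pow_ne_zero _ (Nat.cast_ne_zero.mpr P.L_pos.ne'))))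
    · show ∑ t, WithLp.ofLp n (chartV1 D b t) = 0
      rw [sum_chartV1, hb]

/-- **(2.4) read on `‖λ‖²`**: for `λ ∈ ker Q′`, `‖λ‖² = Σ_{(j,y)} Σ_{x∈B^j(y)} λ(x)²` over the blocks above level 0 (`λ = 0` on `Λ₀`; every other site lies in exactly
one `B^j(y)`, `y ∈ Λ_j`, `j ≥ 1`). [cite: Balaban1984PropagatorsII, (2.4) p.224, (2.7) p.224] -/
theorem normSq_eq_sum_blocks_of_mem_ker {n : ScalarSpace P} (hn : n ∈ LinearMap.ker (QpE D)) :
    ‖n‖ ^ 2 = ∑ b : LevelBlock D, ∑ x ∈ iterBlock b.lvl b.site, n x ^ 2 := by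
  classical
  have hg := (mem_ker_QpE_iff D n).mp hn
  rw [← real_inner_self_eq_norm_sq, inner_eq_sum]
  -- the blocks are pairwise disjoint and cover every site where `λ ≠ 0`
  have hdisj : ((Finset.univ : Finset (LevelBlock D)) : Set (LevelBlock D)).PairwiseDisjoint fun b => iterBlock b.lvl b.site := by
    intro b _ b' _ hbb
    refine Finset.disjoint_left.mpr fun x hx hx' => hbb ?_
    rw [mem_iterBlock] at hx hx'
    have hj : b.lvl = b'.lvl := D.lamSite_iterBlockOf_unique (x := x) (by rw [hx]; exact b.lamSite) (by rw [hx']; exact b'.lamSite)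
    obtain ⟨j, y, hy⟩ := b
    obtain ⟨j', y', hy'⟩ := b'
    have hjj : j = j' := Fin.ext hj
    subst hjj
    have hyy : y = y' := hx.symm.trans hx'
    subst hyy
    rfl
  have h2 : ∑ i, WithLp.ofLp n i * WithLp.ofLp n i = ∑ i, WithLp.ofLp n i ^ 2 := Finset.sum_congr rfl fun i _ => by ring
  rw [h2, ← Finset.sum_biUnion hdisj]
  symm
  refine Finset.sum_subset (Finset.subset_univ _) fun x _ hx => ?_
  -- a site in no block above level 0 lies over `Λ₀`, where `λ = 0`
  obtain ⟨j, hjk, hj⟩ := D.exists_lamSite_iterBlockOf x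
  by_cases hj0 : j = 0
  · subst hj0
    have h0 : WithLp.ofLp n x = 0 := by simpa [siteAvgIter] using hg 0 x (by simpa using hj)
    rw [h0]; ring
  · exfalso
    apply hx
    rw [Finset.mem_biUnion]
    exact ⟨⟨⟨j, Nat.lt_succ_of_le hjk⟩, ⟨iterBlockOf j x, hj, Nat.one_le_iff_ne_zero.mpr hj0⟩⟩, Finset.mem_univ _, by simp⟩

/-- ★★★ **(2.11) ON THE V1 MODEL, LEVEL BY LEVEL**: for `λ ∈ ker Q′`, `8·c²·Σ_{(j,y)} (L^j)^{−2}·Σ_{x∈B^j(y)} λ(x)² ≤ ‖∂λ‖²` (p03's `ineq211_eight` on the block system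
`blockSystemV1 D`, blocks read on the V1 carriers). [cite: Balaban1984PropagatorsII, (2.11) p.225; Balaban1983RegularityDecay, (2.27) p.580] -/
theorem poincare211_levels_V1 (c : ℝ) {n : ScalarSpace P} (hn : n ∈ LinearMap.ker (QpE D)) :
    8 * c ^ 2 * ∑ b : LevelBlock D, (∑ x ∈ iterBlock b.lvl b.site, n x ^ 2) / ((P.L : ℝ) ^ b.lvl) ^ 2 ≤ ‖dE c n‖ ^ 2 := by
  classical
  have h := (blockSystemV1 D).ineq211_eight (WithLp.ofLp n) (inGaugeSpace_of_mem_ker D hn)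
  -- read the block masses and the form on the V1 carriers
  have hmass : ∀ b : LevelBlock D, (blockSystemV1 D).blockMass (WithLp.ofLp n) b / ((((blockSystemV1 D).side b : ℝ) + 1) * (blockSystemV1 D).η) ^ 2
      = (∑ x ∈ iterBlock b.lvl b.site, n x ^ 2) / ((P.L : ℝ) ^ b.lvl) ^ 2 := by
    intro b
    have hs : (((blockSystemV1 D).side b : ℝ) + 1) = (P.L : ℝ) ^ b.lvl := by
      show ((sideV1 D b : ℝ) + 1) = _
      exact_mod_cast sideV1_succ D b
    rw [hs, BlockSystem.blockMass]
    change (∑ t : Fin P.d → Fin (sideV1 D b + 1), (1 : ℝ) ^ P.d * WithLp.ofLp n (chartV1 D b t) ^ 2) / ((P.L : ℝ) ^ b.lvl * 1) ^ 2 = _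
    simp only [one_pow, one_mul, mul_one]
    rw [show (∑ t : Fin P.d → Fin (sideV1 D b + 1), WithLp.ofLp n (chartV1 D b t) ^ 2) = ∑ x ∈ iterBlock b.lvl b.site, WithLp.ofLp n x ^ 2
      from sum_chartV1 D b (fun x => WithLp.ofLp n x ^ 2)]
  simp only [hmass] at h
  rw [← form_blockSystemV1 D c n]
  calc 8 * c ^ 2 * ∑ b : LevelBlock D, (∑ x ∈ iterBlock b.lvl b.site, n x ^ 2) / ((P.L : ℝ) ^ b.lvl) ^ 2
      = c ^ 2 * (8 * ∑ b : LevelBlock D, (∑ x ∈ iterBlock b.lvl b.site, n x ^ 2) / ((P.L : ℝ) ^ b.lvl) ^ 2) := by ring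
    _ ≤ c ^ 2 * (blockSystemV1 D).form (WithLp.ofLp n) := mul_le_mul_of_nonneg_left h (sq_nonneg c)

/-- ★★★ **THE (2.11) LETTER OF THE V1 MODEL: `(8c²∕L^{2k})·‖λ‖² ≤ ‖∂λ‖²` for every `λ ∈ N(Q′) = ker Q′`** (levels `j ≤ k` bounded by the top one; `λ = 0` on `Λ₀`) —
the `hP` letter of `B6SectADeltaACoerciveReductionV1.deltaAE_coercive_of_treeGauge_letters` with `π = 8c²∕L^{2k}` (print's normalisation `c = η⁻¹ = L^k` gives `π = 8`).
[cite: Balaban1984PropagatorsII, (2.11) p.225; Balaban1983RegularityDecay, (2.27) p.580] -/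
theorem poincare211_V1 (c : ℝ) {n : ScalarSpace P} (hn : n ∈ LinearMap.ker (QpE D)) :
    8 * c ^ 2 / ((P.L : ℝ) ^ D.k) ^ 2 * ‖n‖ ^ 2 ≤ ‖dE c n‖ ^ 2 := by
  refine le_trans ?_ (poincare211_levels_V1 D c hn)
  rw [normSq_eq_sum_blocks_of_mem_ker D hn, Finset.mul_sum, Finset.mul_sum]
  refine Finset.sum_le_sum fun b _ => ?_
  have hL : (1 : ℝ) ≤ P.L := by exact_mod_cast P.L_pos
  have hb : ((P.L : ℝ) ^ b.lvl) ^ 2 ≤ ((P.L : ℝ) ^ D.k) ^ 2 :=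
    pow_le_pow_left₀ (by positivity) (pow_le_pow_right₀ hL (D.le_of_lamSite b.lamSite)) 2
  have hS : 0 ≤ ∑ x ∈ iterBlock b.lvl b.site, n x ^ 2 := Finset.sum_nonneg fun _ _ => sq_nonneg _
  rw [div_mul_eq_mul_div, mul_div_assoc]
  refine mul_le_mul_of_nonneg_left ?_ (by positivity)
  exact div_le_div_of_nonneg_left hS (by positivity) hb

end

end Literature.MathematicalPhysics.QuantumFieldTheory.Balaban1983to89.B6SectAPoincare211V1
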